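import Summits.QuantumFields.BalabanUV.T4Continuum.Spine.NE1p.DressedTransportAssembled

/-!
# T⁴ programme, spine estimate NE1′ (node O3b/H2) — END-F′-RATIO: the assembled transport leaf whose booked link is stated in the
# ONE frame-independent quantity it uses, the transverse fresh defect RELATIVE TO THE CURRENT CHART RADIUS; no radius floor, no
# source-vs-floor scalar (swarm row S2 of `t4/formal/NE1p/LEAVES.md`, supplier item S2c; reply to FINDING F-ne1pleaf08-1)

Cell `pub-balaban`, sub-cell `t4`, BINDER-OWNERS row NE1′, NE1′ FORMALISATION SWARM `b2b-balaban-t4-ne1p-formalise-*`, leaf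
prover 01 (unit `b2b-balaban-t4-ne1p-formalise-leaf-01`); owner lineage t4-ne1p-p1 (skeleton `t4/skeletons/NE1p-t4-ne1p-p1.md`
v1.1 §6 seat S2); tree target `Summits/QuantumFields/BalabanUV/T4Continuum/Spine/NE1p/`; ADDITIVE — imports
`Spine/NE1p/DressedTransportAssembled` (END-F′, `sum_gen_le_sum_fam`, `envVar_eq_const_mul`) ONLY; modifies nothing.

WHY (FINDING F-ne1pleaf08-1, CLAIMS.log l.8748, leaf-08; leaf-04's cost lemma `DressedTransportScheduled.floor_window_budget`).
END-F′ (`transportLeaf_assembled`, p212485) books the link «function-level fresh budget ≤ dressed budget share» through a UNIFORM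
chart-radius floor `r_* ≤ ϱ f k″ k` and the scalar `‖c b k‖·r ≤ m·r_*`.  Composed with a window schedule that consumes a
complex margin `ϱ₁ k > ϱ > r_*` at EVERY met step, a K-free `r_*` forces a birth window growing linearly in the cutoff — a
K-dependence introduced by the TYPES, not by [Balaban1989LargeFieldII].  The uniform floor is a booking choice: the Cauchy
constant of a generation's fresh response is `4·Asz/rs` with the CURRENT radius `rs`, and the only quantity the link needs is
the RATIO `δf / rs` per live generation.  This file states the link in exactly that currency and nothing else:
* §1 `budgetShare_le_of_ratio` [arith]: slice sizes `0 ≤ A ≤ gen·stepProd α`, live generations ⊆ live families × born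
  scales, and per live generation `0 ≤ δ` and `‖c‖·(δ / rs) ≤ m·(c_δ/r)·ψ^{k−k″}` ⟹ `‖c‖·Σ 4·A/rs·δ ≤ m·Σ_f envVar (4c_δ/r)
  (ψ·α) f k`.  No floor, no sign of `rs`, `m ≥ 0`.
* §2 the two inductions of END-F′ as REUSABLE lemmas: `asz_le_of_budgetHistory` (under the function-level budget history every
  live generation has `0 ≤ Asz f k″ k ≤ gen f k″·stepProd α k″ k`; step factor `e^{3(s+s1)} ≤ e³ ≤ α`) and
  `ranBelow_strengthen` (a history under `G` is a history under `G ∧ P` as soon as `P k` follows from the strengthened history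
  below `k` and `G k`; generic).
* §3 **`transportLeaf_assembled_ratio`** — END-F′ with {`hrstar`, `hrstar_r`, `hϱfloor`, `hcm`, `hδf`} REPLACED by {`hm : 0 ≤ m`,
  **`hlink : ∀ b k, ∀ p ∈ Sg k b, 0 ≤ δf b k p ∧ ‖c b k‖·(δf b k p / rs p.1 p.2 k) ≤ m·(c_δ/r)·ψ^{k − p.2}`**}; every other
  binder VERBATIM END-F′'s; conclusion VERBATIM the field type of `BookingLeaves.htr` at rate `ψ·α`.  The chart radii may now
  shrink as the window schedule requires (geometric margins ⟹ K-free birth window); the price is displayed ONLY in `hlink`,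
  i.e. in the (I4′) rate reading where it belongs (wall F-6 ∕ trigger k3: whether the cell's fresh pairs satisfy it K-free is
  NOT decided here).  leaf-04's caution (CLAIMS.log l.8924 (ii)) is visible at the interface: `hlink` is per GENERATION while
  `hmargin` synchronises radii per met COMPONENT.
* §4 `hlink_of_floor` [arith]: END-F′'s uniform-floor data (`r_* ≤ rs`, `δf ≤ c_δψ^{k−k″}`, `‖c‖·r ≤ m·r_*`) ⟹ `hlink` — so END-F′
  is the ratio END plus a floor; a geometric age-floor `r·q^{k+1−k″} ≤ rs` with `‖c‖ ≤ q·m` likewise gives `hlink` at rate `ψ/q`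
  (leaf-08's (R-a); not filed here).

HONEST FRAMING.  Rung (B)+1 bookkeeping on ONE finite four-torus of fixed physical size — NOT infinite volume, NOT a mass gap, NOT
OS on ℝ⁴, NOT the Clay problem, NOT summit progress.  NE1′ is NOT PRINTED and NOT PROVED; headline «L-T ⇐ F-1, F-2 (+ H2
dictionary), F-3, F-5, F-6 (incl. `hlink`), F-7, F-8, F-9», never «NE1′ proved»; 0 binders are instantiated on Bałaban's densities;
no `def`, no `def … : Prop`; nothing of [Balaban1989LargeFieldII] is asserted.  [folklore] kernel glue, 0 sorry, 0 citations
used as hypothesis-free facts.  Spine PROVED 0∕9 unchanged.  HONEST DEPENDENCY: continuum YM on T⁴ ⇐ BetaPertH ∧ nine spine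
estimates (0/9 proved); BetaPertH ⇐ (D1) ∧ (D4) ∧ CAP+tail; G-an2-4 gates asym, D1 and NE2/3/4.
-/

noncomputable section

namespace Summit.QuantumFields.BalabanUV.T4Continuum.NE1p.DressedTransportAssembledRatio

open MeasureTheory Set Metric Filter Finset
open scoped BigOperators
open Literature.MathematicalPhysics.QuantumFieldTheory.Balaban1983to89
open Literature.MathematicalPhysics.QuantumFieldTheory.Balaban1983to89.T4TermFormat
open Literature.MathematicalPhysics.QuantumFieldTheory.Balaban1983to89.T4TermFormat.Booking
open Literature.MathematicalPhysics.QuantumFieldTheory.Balaban1983to89.T4GatedBooking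
open Literature.MathematicalPhysics.QuantumFieldTheory.Balaban1983to89.T4TrajectoryComparison
open Literature.MathematicalPhysics.QuantumFieldTheory.Balaban1983to89.T4TrajectoryModulus
open Summit.QuantumFields.BalabanUV.T4Continuum.T4TrajectoryDensityDressed
open Summit.QuantumFields.BalabanUV.T4Continuum.NE1p.DressedRoot
open Summit.QuantumFields.BalabanUV.T4Continuum.NE1p.DressedTransportAssembled
open T4BirthChartTransport (GaugeInvariant BirthSlice RelGauge)
open T4BlockTransport (Fld NDir latMove latN latMove_zero)
open T4TrajectoryDensity

/-! ## §1 The booked link in the ratio currency [arith] -/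

section BookedLink

variable {B : T4TermFormat.Booking} {T : Trajectory B}

/-- **THE BOOKED LINK, RATIO FORM** [arith].  At one met component: live generations `p = (f, k″) ∈ Sg` drawn from the live
families `S` with `birthScale f ≤ k″ ≤ k`; slice sizes `0 ≤ A p ≤ gen f k″·stepProd α k″ k`; per live generation a nonnegative
defect with `‖c‖·(δ p / rs p) ≤ m·(c_δ/r)·ψ^{k−k″}`; `α, ψ, c_δ, m ≥ 0`, `r > 0` ⟹
`‖c‖·Σ_{p∈Sg} 4·A p / rs p·δ p ≤ m·Σ_{f∈S} envVar (4c_δ/r) (ψ·α) f k`.  NO floor and NO sign is asked of the radii `rs`.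
Generation by generation `4A·(‖c‖δ/rs) ≤ 4·gen·stepProd α·m·(c_δ/r)ψ^{k−k″} = m·(4c_δ/r)·stepProd (ψα) k″ k·gen` (`stepProd_psi_mul`),
then regrouped under families (`sum_gen_le_sum_fam`) into the raw envelope (`envVar_eq_const_mul`). [folklore] -/
theorem budgetShare_le_of_ratio {Sg : Finset (B.Birth × ℕ)} {S : Finset B.Birth} {k : ℕ} {A rs δ : B.Birth × ℕ → ℝ}
    {α : ℕ → ℝ} {cnorm cδ ψ r m : ℝ}
    (hα : ∀ i, 0 ≤ α i) (hψ : 0 ≤ ψ) (hcδ : 0 ≤ cδ) (hr : 0 < r) (hm : 0 ≤ m)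
    (hSg : ∀ p ∈ Sg, p.1 ∈ S ∧ B.birthScale p.1 ≤ p.2 ∧ p.2 ≤ k)
    (hA : ∀ p ∈ Sg, 0 ≤ A p ∧ A p ≤ T.gen p.1 p.2 * stepProd α p.2 k)
    (hlink : ∀ p ∈ Sg, 0 ≤ δ p ∧ cnorm * (δ p / rs p) ≤ m * (cδ / r) * ψ ^ (k - p.2)) :
    cnorm * ∑ p ∈ Sg, 4 * A p / rs p * δ p ≤ m * ∑ f ∈ S, T.envVar (4 * cδ / r) (fun i => ψ * α i) f k := by
  classical
  set Y : B.Birth × ℕ → ℝ := fun p => stepProd (fun i => ψ * α i) p.2 k * T.gen p.1 p.2 with hY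
  have hY0 : ∀ p : B.Birth × ℕ, 0 ≤ Y p := fun p => by
    rw [hY]
    exact mul_nonneg (stepProd_nonneg (fun i => mul_nonneg hψ (hα i)) _ _) (T.gen_nonneg _ _)
  have hK0 : 0 ≤ m * (4 * cδ / r) := by positivity
  -- generation by generation
  have hterm : ∀ p ∈ Sg, cnorm * (4 * A p / rs p * δ p) ≤ m * (4 * cδ / r) * Y p := by
    intro p hp
    obtain ⟨hA0, hAle⟩ := hA p hp
    obtain ⟨-, hl⟩ := hlink p hp
    have hb' : 0 ≤ m * (cδ / r) * ψ ^ (k - p.2) := by positivity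
    have e1 : cnorm * (4 * A p / rs p * δ p) = 4 * A p * (cnorm * (δ p / rs p)) := by ring
    rw [e1]
    calc 4 * A p * (cnorm * (δ p / rs p)) ≤ 4 * A p * (m * (cδ / r) * ψ ^ (k - p.2)) :=
          mul_le_mul_of_nonneg_left hl (by linarith)
      _ ≤ 4 * (T.gen p.1 p.2 * stepProd α p.2 k) * (m * (cδ / r) * ψ ^ (k - p.2)) :=
          mul_le_mul_of_nonneg_right (by linarith) hb'
      _ = m * (4 * cδ / r) * Y p := by
          rw [hY]
          simp only
          rw [stepProd_psi_mul]
          ring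
  -- regroup under families: the raw envelope with constant 1
  have hregroup : ∑ p ∈ Sg, Y p ≤ ∑ f ∈ S, T.envVar 1 (fun i => ψ * α i) f k := by
    have h := sum_gen_le_sum_fam (X := Y) hSg (fun f _ k'' _ _ => hY0 (f, k''))
    refine h.trans (le_of_eq (sum_congr rfl fun f _ => ?_))
    unfold Trajectory.envVar
    exact sum_congr rfl fun k'' _ => by rw [hY, one_mul]
  calc cnorm * ∑ p ∈ Sg, 4 * A p / rs p * δ p = ∑ p ∈ Sg, cnorm * (4 * A p / rs p * δ p) := by rw [mul_sum]
    _ ≤ ∑ p ∈ Sg, m * (4 * cδ / r) * Y p := sum_le_sum hterm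
    _ = m * (4 * cδ / r) * ∑ p ∈ Sg, Y p := by rw [← mul_sum]
    _ ≤ m * (4 * cδ / r) * ∑ f ∈ S, T.envVar 1 (fun i => ψ * α i) f k := mul_le_mul_of_nonneg_left hregroup hK0
    _ = m * ∑ f ∈ S, T.envVar (4 * cδ / r) (fun i => ψ * α i) f k := by
        rw [mul_assoc, mul_sum]
        exact congrArg (m * ·) (sum_congr rfl fun f _ => (envVar_eq_const_mul _ _ f k).symm)

end BookedLink

/-! ## §2 The two inductions of END-F′ as reusable lemmas [bookkeeping] -/

section Inductions

variable {B : T4TermFormat.Booking} {T : Trajectory B}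

/-- **THE SIZE LAW OF EVERY LIVE GENERATION UNDER THE FUNCTION-LEVEL BUDGET HISTORY** [bookkeeping]: with the size recursion
`Asz f k″ k″ = gen f k″`, `Asz f k″ (k+1) = e^{3(s f k + s1 f k)}·Asz f k″ k` and the step domination `e³ ≤ α k` (whenever a
generation is alive at `k` and `k + 1 ≤ K`), the history «every family alive at `i` has `s b i + s1 b i ≤ 1`» below `k` gives
`0 ≤ Asz f k″ k ≤ gen f k″·stepProd α k″ k` for every generation alive at `k ≤ K`. [folklore] -/
theorem asz_le_of_budgetHistory {s s1 : B.Birth → ℕ → ℝ} {α : ℕ → ℝ} {Asz : B.Birth → ℕ → ℕ → ℝ}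
    (hα : ∀ i, 0 ≤ α i)
    (he3 : ∀ (f : B.Birth) (k'' k : ℕ), B.birthScale f ≤ k'' → k'' ≤ k → k + 1 ≤ B.K → Real.exp 3 ≤ α k)
    (hAsz_birth : ∀ f k'', Asz f k'' k'' = T.gen f k'')
    (hAsz_step : ∀ f k'' k, B.birthScale f ≤ k'' → k'' ≤ k →
      Asz f k'' (k + 1) = Real.exp (3 * (s f k + s1 f k)) * Asz f k'' k) :
    ∀ k, k ≤ B.K → RanBelow (fun i => ∀ b : B.Birth, B.birthScale b ≤ i → s b i + s1 b i ≤ 1) k →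
      ∀ (f : B.Birth) (k'' : ℕ), B.birthScale f ≤ k'' → k'' ≤ k →
        0 ≤ Asz f k'' k ∧ Asz f k'' k ≤ T.gen f k'' * stepProd α k'' k := by
  intro k
  induction k with
  | zero =>
    intro _ _ f k'' _ hk''
    obtain rfl : k'' = 0 := Nat.le_zero.mp hk''
    rw [hAsz_birth, stepProd_self, mul_one]
    exact ⟨T.gen_nonneg f 0, le_rfl⟩
  | succ k ih =>
    intro hK hran f k'' hf hk''
    rcases Nat.lt_or_eq_of_le hk'' with hlt | heq
    · have hk''k : k'' ≤ k := Nat.lt_succ_iff.mp hlt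
      have hkK : k < B.K := Nat.lt_of_succ_le hK
      obtain ⟨hA0, hAle⟩ := ih hkK.le (hran.mono k.le_succ) f k'' hf hk''k
      have hbud : s f k + s1 f k ≤ 1 := hran k (Nat.lt_succ_self k) f (hf.trans hk''k)
      have hstep : Real.exp (3 * (s f k + s1 f k)) ≤ α k :=
        (Real.exp_le_exp.mpr (by linarith)).trans (he3 f k'' k hf hk''k hK)
      rw [hAsz_step f k'' k hf hk''k, stepProd_succ α hk''k]
      refine ⟨mul_nonneg (Real.exp_pos _).le hA0, ?_⟩
      calc Real.exp (3 * (s f k + s1 f k)) * Asz f k'' k ≤ α k * (T.gen f k'' * stepProd α k'' k) :=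
            mul_le_mul hstep hAle hA0 (hα k)
        _ = T.gen f k'' * (stepProd α k'' k * α k) := by ring
    · subst heq
      rw [hAsz_birth, stepProd_self, mul_one]
      exact ⟨T.gen_nonneg f _, le_rfl⟩

/-- **STRENGTHENING A HISTORY** [bookkeeping]: if at every scale `k < K` the strengthened history `RanBelow (G ∧ P) k` together
with the gate `G k` yields `P k`, then every history under `G` up to `K` is a history under `G ∧ P` (induction on the scale).
Generic; used with `G := budgetGate …` and `P i := ∀ b alive at i, s b i + s1 b i ≤ 1`. [folklore] -/
theorem ranBelow_strengthen {G P : ℕ → Prop}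
    (hstep : ∀ k, k < B.K → RanBelow (fun i => G i ∧ P i) k → G k → P k) :
    ∀ k, k ≤ B.K → RanBelow G k → RanBelow (fun i => G i ∧ P i) k := by
  intro k
  induction k with
  | zero => exact fun _ _ => ranBelow_zero _
  | succ k ih =>
    intro hK hran
    have hkK : k < B.K := Nat.lt_of_succ_le hK
    have hran' : RanBelow (fun i => G i ∧ P i) k := ih hkK.le (hran.mono k.le_succ)
    exact hran'.succ ⟨hran k (Nat.lt_succ_self k), hstep k hkK hran' (hran k (Nat.lt_succ_self k))⟩

end Inductions

/-! ## §3 END-F′-RATIO: the assembled transport leaf with the booked link in the ratio currency [bookkeeping] -/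

section FunctionLevel

variable {B : T4TermFormat.Booking} {T : Trajectory B}
variable {R : Type*} [NormedRing R] [NormedAlgebra ℂ R] [MeasurableSpace R] {d : ℕ}

/-- **END-F′-RATIO — THE TRANSPORT LEAF `htr` OF `BookingLeaves`, CENTRED SLICE ASSEMBLED UNDER THE HISTORY, LINK IN THE RATIO
CURRENCY** [bookkeeping]: `DressedTransportAssembled.transportLeaf_assembled` (END-F′) with its uniform-floor data {`hrstar`,
`hrstar_r`, `hϱfloor`, `hcm`, `hδf`} REPLACED by {`hm : 0 ≤ m`, `hlink`}: per met component `(b, k)` and live generation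
`p = (f, k″) ∈ Sg k b`, the transverse fresh defect is nonnegative and, RELATIVE TO THE CURRENT CHART RADIUS `rs f k″ k`, obeys
`‖c b k‖·(δf b k p / rs f k″ k) ≤ m·(c_δ/r)·ψ^{k−k″}` — the (I4′) rate reading in the one frame-independent currency the Cauchy
estimate of the fresh response uses; NO radius floor; the radii may shrink as the schedule requires.  Every other binder is
END-F′'s VERBATIM: (w1) `hsl`, H2 `hFn`/`h𝒢`/`hQ`/`hSg`/`hs1`/`hAsz_*`/`hrs_*`/`hmeas`, (w2-act) `hB`/`hE`, `hDμ`/`hD`, (w3)⁺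
`hN1`/`hN2`/`hdiam`/`hθ`/`hN1x`/`hN2cx`/`hmargin`/`hrs_dec`, (w4) `hdom`, (I4′) `hpairx`/`hδfw`/`hdefw`/`hrate`, `hinv`, `hlin`,
positivity.  Inside: `asz_le_of_budgetHistory` + `budgetShare_le_of_ratio` + `ranBelow_strengthen` + `pertSlice_under_history`
(with the strengthened gate) + `PertSlice.mono`, then END-F BY NAME.  Conclusion: EXACTLY the field `htr` of `BookingLeaves`
(`C = 4c_δ/r`, `ρ i = ψ·α i`).  Nothing of Bałaban's densities is asserted. [folklore] -/
theorem transportLeaf_assembled_ratio {Fn : B.Birth → ℕ → ℕ → Fld d R → ℂ}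
    {rel : B.Birth → ℕ → ℕ → Fld d R → Fld d R → Prop} {𝒦 : B.Birth → ℕ → ℕ → Set (Fld d R)}
    {ref : B.Birth → ℕ → Fld d R → Fld d R} {base : B.Birth → ℕ → Fld d R → ℝ}
    {𝒜 𝒬 : B.Birth → ℕ → Fld d R → Fld d R → ℂ} {q : B.Birth → ℕ → Fld d R → ℂ}
    {μ : B.Birth → ℕ → Measure (Fld d R)} {z₀ z₁ : B.Birth → ℕ → Fld d R} {D : B.Birth → ℕ → Set (Fld d R)}
    {defect : B.Birth → ℕ → ℕ → ℝ} {cδ ψ w r m : ℝ} {s θ s1 ϱ₁ : B.Birth → ℕ → ℝ} {α : ℕ → ℝ}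
    {ϱ rs Asz : B.Birth → ℕ → ℕ → ℝ} {S : ℕ → B.Birth → Finset B.Birth}
    {Sg : ℕ → B.Birth → Finset (B.Birth × ℕ)} {c : B.Birth → ℕ → ℂ} {δf : B.Birth → ℕ → B.Birth × ℕ → ℝ}
    (hα : ∀ i, 0 ≤ α i) (hr : 0 < r) (hw : 0 < w) (hcδ : 0 ≤ cδ) (hψ : 0 ≤ ψ) (hm : 0 ≤ m)
    (hsl : ∀ (b : B.Birth) (k' : ℕ), B.birthScale b ≤ k' → k' ≤ B.K →
      RanBelow (budgetGate T s m S (4 * cδ / r) (fun i => ψ * α i)) k' →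
      BirthSlice (Fn b k' k') latMove latN (𝒦 b k' k') w r (T.gen b k'))
    (hFn : ∀ (b : B.Birth) (k' k : ℕ), B.birthScale b ≤ k' → k' ≤ k → k + 1 ≤ B.K →
      RanBelow (budgetGate T s m S (4 * cδ / r) (fun i => ψ * α i)) (k + 1) →
      ∀ U, Fn b k' (k + 1) U =
        wOp (expWeight (base b k) (𝒜 b k + 𝒬 b k)) (μ b k) (z₀ b k) U (fun z => Fn b k' k (U + z)))
    (h𝒢 : ∀ (b : B.Birth) (k' k : ℕ), B.birthScale b ≤ k' → k' ≤ k → k + 1 ≤ B.K →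
      RanBelow (budgetGate T s m S (4 * cδ / r) (fun i => ψ * α i)) (k + 1) →
      ∀ U, (fun z => Fn b k' k (U + z)) ∈ BddClass ℂ (μ b k))
    (hD : ∀ b k, (D b k).Nonempty) (hϱ : ∀ b k' k, 0 < ϱ b k' k)
    (hB : ∀ (b : B.Birth) (k' k : ℕ), B.birthScale b ≤ k' → k' ≤ k → k + 1 ≤ B.K →
      RanBelow (budgetGate T s m S (4 * cδ / r) (fun i => ψ * α i)) (k + 1) →
      RealBaseAt (ref b k) (base b k) (𝒜 b k) (μ b k) (𝒦 b k' (k + 1)))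
    (hE : ∀ (b : B.Birth) (k' k : ℕ), B.birthScale b ≤ k' → k' ≤ k → k + 1 ≤ B.K →
      RanBelow (budgetGate T s m S (4 * cδ / r) (fun i => ψ * α i)) (k + 1) →
      ExponentSliceAt (ref b k) (𝒜 b k) (μ b k) latMove latN (𝒦 b k' (k + 1)) w (ϱ b k' k) (s b k))
    -- the Assembly's dictionary: the centred observable-attached exponent IS the fresh sum over the live generations
    (hQ : ∀ b k, (fun U z => 𝒬 b k U z - q b k U) =
      fun U z => c b k * ∑ p ∈ Sg k b, (Fn p.1 p.2 k (U + z) - Fn p.1 p.2 k (U + z₁ b k)))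
    (hSg : ∀ k b, ∀ p ∈ Sg k b, p.1 ∈ S k b ∧ B.birthScale p.1 ≤ p.2 ∧ p.2 ≤ k)
    (hs1 : ∀ b k, s1 b k = ‖c b k‖ * ∑ p ∈ Sg k b, 4 * Asz p.1 p.2 k / rs p.1 p.2 k * δf b k p)
    (hAsz_birth : ∀ f k'', Asz f k'' k'' = T.gen f k'') (hrs_birth : ∀ f k'', rs f k'' k'' = r)
    (hAsz_step : ∀ f k'' k, B.birthScale f ≤ k'' → k'' ≤ k →
      Asz f k'' (k + 1) = Real.exp (3 * (s f k + s1 f k)) * Asz f k'' k)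
    (hrs_step : ∀ f k'' k, B.birthScale f ≤ k'' → k'' ≤ k → rs f k'' (k + 1) = ϱ f k'' k)
    (hrs_dec : ∀ f k'' k, B.birthScale f ≤ k'' → k'' ≤ k → ϱ f k'' k < rs f k'' k)
    (hmargin : ∀ (b : B.Birth) (k' k : ℕ), B.birthScale b ≤ k' → k' ≤ k →
      ϱ b k' k < ϱ₁ b k ∧ 0 < ϱ₁ b k ∧ ∀ p ∈ Sg k b, ϱ₁ b k ≤ rs p.1 p.2 k)
    -- THE BOOKED LINK, per live generation: the transverse fresh defect RELATIVE TO THE CURRENT CHART RADIUS decays at the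
    -- transport rate, source factor against budget factor ((I4′) reading; displayed, never asserted)
    (hlink : ∀ b k, ∀ p ∈ Sg k b, 0 ≤ δf b k p ∧ ‖c b k‖ * (δf b k p / rs p.1 p.2 k) ≤ m * (cδ / r) * ψ ^ (k - p.2))
    (hδfw : ∀ b k, ∀ p ∈ Sg k b, δf b k p ≤ w)
    (hDμ : ∀ b k, ∀ᵐ z ∂μ b k, z ∈ D b k)
    (hN1 : ∀ (b : B.Birth) (k' k : ℕ), B.birthScale b ≤ k' → k' ≤ k → k + 1 ≤ B.K →
      ∀ z ∈ D b k, ∀ U ∈ 𝒦 b k' (k + 1), U + z ∈ 𝒦 b k' k)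
    (hN2 : ∀ (b : B.Birth) (k' k : ℕ), B.birthScale b ≤ k' → k' ≤ k → k + 1 ≤ B.K →
      ∀ U₀ ∈ 𝒦 b k' (k + 1), ∀ p : NDir d R, latN p ≤ w → ∀ z' ∈ D b k, latMove U₀ p 1 + z' ∈ 𝒦 b k' k)
    (hN1x : ∀ (b : B.Birth) (k' k : ℕ), B.birthScale b ≤ k' → k' ≤ k →
      ∀ p ∈ Sg k b, ∀ z ∈ D b k, ∀ U ∈ 𝒦 b k' (k + 1), U + z ∈ 𝒦 p.1 p.2 k)
    (hN2cx : ∀ (b : B.Birth) (k' k : ℕ), B.birthScale b ≤ k' → k' ≤ k →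
      ∀ p ∈ Sg k b, ∀ U₀ ∈ 𝒦 b k' (k + 1), ∀ pd : NDir d R, 0 < latN pd → latN pd ≤ w →
        ∀ t ∈ tube (ϱ₁ b k / latN pd), latMove U₀ pd t + z₁ b k ∈ 𝒦 p.1 p.2 k)
    (hpairx : ∀ (b : B.Birth) (k' k : ℕ), B.birthScale b ≤ k' → k' ≤ k →
      ∀ p ∈ Sg k b, ∀ U₀ ∈ 𝒦 b k' (k + 1), ∀ pd : NDir d R, 0 < latN pd → latN pd ≤ w →
        ∀ᵐ z ∂μ b k, ∀ t ∈ tube (ϱ₁ b k / latN pd),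
          RelGauge (rel p.1 p.2 k) latMove latN (latMove U₀ pd t + z₁ b k) (latMove U₀ pd t + z) (δf b k p))
    (hdiam : ∀ b k, ∀ z ∈ D b k, ∀ z' ∈ D b k, ∀ x ν, ‖z x ν - z' x ν‖ ≤ θ b k)
    (hθ : ∀ b k, 0 < θ b k ∧ θ b k ≤ w)
    (hdom : ∀ (b : B.Birth) (k' k : ℕ), B.birthScale b ≤ k' → k' ≤ k → k + 1 ≤ B.K →
      Real.exp 3 * (1 + 4 * θ b k / ϱ b k' k) ≤ α k)
    (hinv : ∀ b k' k, GaugeInvariant (rel b k' k) (Fn b k' k))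
    (hmeas : ∀ (b f : B.Birth) (k'' k : ℕ) (U : Fld d R), AEStronglyMeasurable (fun z => Fn f k'' k (U + z)) (μ b k))
    (hdefw : ∀ b k' k, defect b k' k ≤ w)
    (hrate : ∀ (b : B.Birth) (k' k : ℕ), B.birthScale b ≤ k' → k' ≤ k → k ≤ B.K →
      defect b k' k ≤ cδ * ψ ^ (k - k'))
    (hlin : ∀ (b : B.Birth) (k' k : ℕ), B.birthScale b ≤ k' → k' ≤ k → k ≤ B.K →
      RanBelow (budgetGate T s m S (4 * cδ / r) (fun i => ψ * α i)) k → ∀ ε > 0,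
      ∃ U₀ ∈ 𝒦 b k' k, ∃ U₁ : Fld d R, RelGauge (rel b k' k) latMove latN U₀ U₁ (defect b k' k) ∧
        T.lin b k' k ≤ ‖Fn b k' k U₁ - Fn b k' k U₀‖ + ε) :
    T.TransportsFromVar (4 * cδ / r) (fun i => ψ * α i) (budgetGate T s m S (4 * cδ / r) (fun i => ψ * α i)) := by
  classical
  -- the dressed gate and the function-level budget predicate
  set G : ℕ → Prop := budgetGate T s m S (4 * cδ / r) (fun i => ψ * α i) with hG
  set P : ℕ → Prop := fun i => ∀ b : B.Birth, B.birthScale b ≤ i → s b i + s1 b i ≤ 1 with hP_def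
  have hGP_G : ∀ {k : ℕ}, RanBelow (fun i => G i ∧ P i) k → RanBelow G k := fun h => h.imp fun i _ hi => hi.1
  have hGP_P : ∀ {k : ℕ}, RanBelow (fun i => G i ∧ P i) k → RanBelow P k := fun h => h.imp fun i _ hi => hi.2
  -- the uniform step constant is dominated: `e³ ≤ e³(1 + 4θ/ϱ) ≤ α`
  have he3 : ∀ (f : B.Birth) (k'' k : ℕ), B.birthScale f ≤ k'' → k'' ≤ k → k + 1 ≤ B.K → Real.exp 3 ≤ α k := by
    intro f k'' k hf hk'' hK
    have h4 : 0 ≤ 4 * θ f k / ϱ f k'' k := div_nonneg (by linarith [(hθ f k).1]) (hϱ f k'' k).le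
    exact (le_mul_of_one_le_right (Real.exp_pos 3).le (by linarith)).trans (hdom f k'' k hf hk'' hK)
  -- (a) sizes under the function-level budget history
  have hAsz := asz_le_of_budgetHistory (T := T) hα he3 hAsz_birth hAsz_step
  -- (b) the booked link in the ratio currency
  have hs1le : ∀ k, k ≤ B.K → RanBelow P k → ∀ b : B.Birth,
      s1 b k ≤ m * ∑ f ∈ S k b, T.envVar (4 * cδ / r) (fun i => ψ * α i) f k := by
    intro k hK hran b
    rw [hs1 b k]
    exact budgetShare_le_of_ratio (A := fun p => Asz p.1 p.2 k) (rs := fun p => rs p.1 p.2 k) (δ := δf b k) hα hψ hcδ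
      hr hm (hSg k b) (fun p hp => hAsz k hK hran p.1 p.2 (hSg k b p hp).2.1 (hSg k b p hp).2.2) (hlink b k)
  -- (c) the dressed history IS the strengthened history
  have hconv : ∀ k, k ≤ B.K → RanBelow G k → RanBelow (fun i => G i ∧ P i) k :=
    ranBelow_strengthen (B := B) fun k hkK hran hg b hb => by
      have hgb : s b k + m * ∑ f ∈ S k b, T.envVar (4 * cδ / r) (fun i => ψ * α i) f k ≤ 1 := hg b hb
      linarith [hs1le k hkK.le (hGP_P hran) b]
  -- (d) the centred perturbation slice under the history, at the dressed budget's size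
  have hP : ∀ (b : B.Birth) (k' k : ℕ), B.birthScale b ≤ k' → k' ≤ k → k + 1 ≤ B.K → RanBelow G (k + 1) →
      PertSlice (fun U z => 𝒬 b k U z - q b k U) (μ b k) latMove latN (𝒦 b k' (k + 1)) w (ϱ b k' k)
        (m * ∑ f ∈ S k b, T.envVar (4 * cδ / r) (fun i => ψ * α i) f k) := by
    intro b k' k hbk' hk'k hK hran
    have hran' : RanBelow (fun i => G i ∧ P i) (k + 1) := hconv (k + 1) hK hran
    have key := pertSlice_under_history (Gate := fun i => G i ∧ P i) (T := T)
      (fun b k' h1 h2 h3 => hsl b k' h1 h2 (hGP_G h3))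
      (fun b k' k h1 h2 h3 h4 => hFn b k' k h1 h2 h3 (hGP_G h4))
      (fun b k' k h1 h2 h3 h4 => hB b k' k h1 h2 h3 (hGP_G h4))
      (fun b k' k h1 h2 h3 h4 => hE b k' k h1 h2 h3 (hGP_G h4))
      hQ (fun k b p hp => (hSg k b p hp).2) hs1 hAsz_birth hrs_birth hAsz_step hrs_step hrs_dec hmargin hDμ hN1 hN1x
      hN2cx hpairx hδfw hinv hmeas (fun k _ hg b hb => hg.2 b hb) b k' k hbk' hk'k hK hran'
    exact key.mono (hs1le k ((Nat.le_succ k).trans hK) (hGP_P (hran'.mono k.le_succ)) b) le_rfl Subset.rfl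
  -- (e) END-F by name
  exact transportLeaf_of_centredExponent hα hr hw hsl hFn h𝒢 hD hϱ hB hE hP hDμ hN1 hN2 hdiam hθ hdom hinv hdefw hrate
    hlin

end FunctionLevel

/-! ## §4 END-F′'s uniform floor is one way to book the ratio [arith] -/

section Floor

variable {B : T4TermFormat.Booking}

/-- **UNIFORM FLOOR ⟹ RATIO LINK** [arith]: END-F′'s data — current radii floored by `r_* > 0`, transverse defects
`0 ≤ δf ≤ c_δψ^{k−k″}`, source factor against budget factor `‖c b k‖·r ≤ m·r_*` (`r > 0`) — give the `hlink` of
`transportLeaf_assembled_ratio`.  So END-F′ is the ratio END plus a floor (and the floor is where the cutoff-linear birth window of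
`DressedTransportScheduled.floor_window_budget` comes from); an age-geometric floor `r·q^{k+1−k″} ≤ rs`, `‖c‖ ≤ q·m`, would give
`hlink` at rate `ψ/q` the same way. [folklore] -/
theorem hlink_of_floor {Sg : ℕ → B.Birth → Finset (B.Birth × ℕ)} {rs : B.Birth → ℕ → ℕ → ℝ}
    {δf : B.Birth → ℕ → B.Birth × ℕ → ℝ} {c : B.Birth → ℕ → ℂ} {cδ ψ r rstar m : ℝ}
    (hr : 0 < r) (hrstar : 0 < rstar)
    (hrs : ∀ b k, ∀ p ∈ Sg k b, rstar ≤ rs p.1 p.2 k) (hcm : ∀ b k, ‖c b k‖ * r ≤ m * rstar)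
    (hδf : ∀ b k, ∀ p ∈ Sg k b, 0 ≤ δf b k p ∧ δf b k p ≤ cδ * ψ ^ (k - p.2)) :
    ∀ b k, ∀ p ∈ Sg k b, 0 ≤ δf b k p ∧ ‖c b k‖ * (δf b k p / rs p.1 p.2 k) ≤ m * (cδ / r) * ψ ^ (k - p.2) := by
  intro b k p hp
  obtain ⟨hδ0, hδle⟩ := hδf b k p hp
  refine ⟨hδ0, ?_⟩
  have hrsp : 0 < rs p.1 p.2 k := lt_of_lt_of_le hrstar (hrs b k p hp)
  have hratio : ‖c b k‖ / rstar ≤ m / r := by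
    rw [div_le_div_iff₀ hrstar hr]
    linarith [hcm b k]
  have hm0 : 0 ≤ m / r := le_trans (div_nonneg (norm_nonneg _) hrstar.le) hratio
  calc ‖c b k‖ * (δf b k p / rs p.1 p.2 k) ≤ ‖c b k‖ * (δf b k p / rstar) :=
        mul_le_mul_of_nonneg_left (div_le_div_of_nonneg_left hδ0 hrstar (hrs b k p hp)) (norm_nonneg _)
    _ = ‖c b k‖ / rstar * δf b k p := by ring
    _ ≤ m / r * δf b k p := mul_le_mul_of_nonneg_right hratio hδ0
    _ ≤ m / r * (cδ * ψ ^ (k - p.2)) := mul_le_mul_of_nonneg_left hδle hm0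
    _ = m * (cδ / r) * ψ ^ (k - p.2) := by ring

end Floor

end Summit.QuantumFields.BalabanUV.T4Continuum.NE1p.DressedTransportAssembledRatio

end
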